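import Mathlib
import Summits.Ventures.HodgeRepro.Tier4.Common.KTypeSpace

/-!
# Tier4/Line4/RieszSpace — the `T′`-weight, `K`-fixed vectors of a constituent (the space of the Riesz vector of the
`T′`-period), and its relation to the joint `kTypeSpace`

Blind re-derivation cell `pub-hodge-repro`, Tier 4 «prove the step» (README §9–§10), seat t4-L4-p1 (prover, LINE L4,
gen 3; F-L4-JOINT = L4-p2 g3 S13737 / S13756, O-L4-JOINT S13773; the planner's choice of the `T′`-clauses S13808).  Tree path `lean/Summits/Ventures/HodgeRepro/Tier4/Line4/RieszSpace.lean`.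

WHAT IS DEFINED.  `rieszSpace W q g g' eP' eM' K V` = plan-4's `kTypeSpace'` (S13808, the `T′`-reading of the repair):
the vectors of `V` with the archimedean weights `(eP′ w, eM′ w)` under
the local torus of the TRANSPORTED torus `T′` at every infinite place and fixed by the level `K` — the clauses of
typer-2's `kTypeSpace` WITHOUT the `T`-weight clause.  Why: the Riesz vector of the `T′`-period functional `P_{χ′}` is a
`T′`-weight vector (the period against `χ′` kills every other `T′`-weight), `K`-fixed; its `T`-period `P_χ` picks the
`χ`-matching `T`-weight COMPONENT — no vector needs to be a weight vector for both tori.  The joint space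
`kTypeSpace … K V` (both tori on one vector) is contained in it (`kTypeSpace_le_rieszSpace`) and is `⊥` whenever the
two compact tori at the ball place differ, for every admissible `V` (F-L4-JOINT: one-dimensional weight spaces of the
weight-3 discrete series of `U(1,1)`), so a wall whose conclusion quantifies the Riesz vector over `kTypeSpace` has
no genuine instance off the diagonal datum; `rieszSpace` is the honest carrier.

Nothing here says anything about the status of the Hodge conjecture for CM abelian varieties, which is NOT proved
(HC_CM is NOT proved by anyone in this repository).
-/

set_option autoImplicit false

noncomputable section

namespace Summit.Ventures.HodgeRepro.Tier4.Line4

open Summit.Ventures.HodgeRepro.Tier4.Common NumberField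

section RieszSpace

variable {k : Type} [Field k] [NumberField k] (W : PlaneData k)

/-- **The `T′`-weight, `K`-fixed vectors of `V`**: the carrier of the Riesz vector of the `T′`-period (typer-2's
`kTypeSpace` without the `T`-weight clause). -/
def rieszSpace (q : QuadData k) (g g' : Matrix (Fin 4) (Fin 4) k) (eP' eM' : InfinitePlace k → ℤ)
    (K : Subgroup (GA W)) (V : Submodule ℂ (GA W → ℂ)) : Submodule ℂ (GA W → ℂ) where
  carrier := {f | f ∈ V ∧
    (∀ (w : InfinitePlace k) (x κ : GA W), κ ∈ localTorusAt' W w →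
      f (x * κ) = weightAt' W q w g g' 0 κ ^ eP' w * weightAt' W q w g g' 1 κ ^ eM' w * f x) ∧
    ∀ (x κ : GA W), κ ∈ K → f (x * κ) = f x}
  zero_mem' := ⟨V.zero_mem, fun _ _ _ _ => by simp, fun _ _ _ => rfl⟩
  add_mem' := by
    rintro f f' ⟨hf, hfT', hfK⟩ ⟨hf', hf'T', hf'K⟩
    refine ⟨V.add_mem hf hf', fun w x κ hκ => ?_, fun x κ hκ => ?_⟩
    · simp only [Pi.add_apply, hfT' w x κ hκ, hf'T' w x κ hκ]
      ring
    · simp only [Pi.add_apply, hfK x κ hκ, hf'K x κ hκ]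
  smul_mem' := by
    rintro c f ⟨hf, hfT', hfK⟩
    refine ⟨V.smul_mem c hf, fun w x κ hκ => ?_, fun x κ hκ => ?_⟩
    · simp only [Pi.smul_apply, smul_eq_mul, hfT' w x κ hκ]
      ring
    · simp only [Pi.smul_apply, smul_eq_mul, hfK x κ hκ]

/-- `rieszSpace ≤ V`. -/
theorem rieszSpace_le (q : QuadData k) (g g' : Matrix (Fin 4) (Fin 4) k) (eP' eM' : InfinitePlace k → ℤ)
    (K : Subgroup (GA W)) (V : Submodule ℂ (GA W → ℂ)) : rieszSpace W q g g' eP' eM' K V ≤ V :=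
  fun _ hf => hf.1

/-- The joint `K`-type space lies in the `T′`-Riesz space. -/
theorem kTypeSpace_le_rieszSpace (q : QuadData k) (g g' : Matrix (Fin 4) (Fin 4) k)
    (eP eM eP' eM' : InfinitePlace k → ℤ) (K : Subgroup (GA W)) (V : Submodule ℂ (GA W → ℂ)) :
    kTypeSpace W q g g' eP eM eP' eM' K V ≤ rieszSpace W q g g' eP' eM' K V :=
  fun _ hf => ⟨hf.1, hf.2.2.1, hf.2.2.2⟩

/-- `rieszSpace` is monotone in `V`. -/
theorem rieszSpace_mono (q : QuadData k) (g g' : Matrix (Fin 4) (Fin 4) k) (eP' eM' : InfinitePlace k → ℤ)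
    (K : Subgroup (GA W)) {V V' : Submodule ℂ (GA W → ℂ)} (h : V ≤ V') :
    rieszSpace W q g g' eP' eM' K V ≤ rieszSpace W q g g' eP' eM' K V' :=
  fun _ hf => ⟨h hf.1, hf.2.1, hf.2.2⟩

/-- The `T′`-Riesz space of the zero subspace is zero (plan-4's battery clause, S13808). -/
theorem rieszSpace_bot (q : QuadData k) (g g' : Matrix (Fin 4) (Fin 4) k) (eP' eM' : InfinitePlace k → ℤ)
    (K : Subgroup (GA W)) : rieszSpace W q g g' eP' eM' K ⊥ = ⊥ :=
  le_bot_iff.1 (rieszSpace_le W q g g' eP' eM' K ⊥)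

end RieszSpace

end Summit.Ventures.HodgeRepro.Tier4.Line4

end
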